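import Summits.KontsevichZagierPeriods.KontsevichZagierPeriods.Theorems.HurwitzMicroSectorsNormalFormPrincipleLevelOne
import Summits.KontsevichZagierPeriods.KontsevichZagierPeriods.Theorems.HurwitzMicroSectorsNormalFormPrincipleSlabASubPtK20
import Summits.KontsevichZagierPeriods.KontsevichZagierPeriods.Theorems.HurwitzMicroSectorsNormalFormPrincipleAlgCarriers
import Summits.KontsevichZagierPeriods.KontsevichZagierPeriods.Theorems.HurwitzMicroSectorsNormalFormPrincipleM2FiveZetaTwo

/-!
# `NormalFormPrinciple` (stmt-KontsevichZagierPeriods-3869), line `SketchIdeator1` — leaf `stub_boxRigidity`: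
# level two with real-algebraic coefficients: the squares substitution `(x,y) ↦ (x²,y²)` (rule 2)

Registered sub-goal `levelTwo_squares` of the layer "Conjecture 1 for `[(0,1)², P(x,y)/(1 − x²y²)]`
with `P ∈ (ℚ̄ ∩ ℝ)[x,y]`" (lead file `…AlgLevelTwo`): an odd-odd monomial of level two is carried
onto the algebraic level-one layer by ONE change of variables,
`[(0,1)², c x^{2a+1} y^{2b+1}/(1 − x²y²)] ≡ [(0,1)², (c/4) u^a v^b/(1 − uv)]`.

The chart `Φ(x,y) = (x², y²)` is a `ℚ`-polynomial (hence `ℚ`-semialgebraic) map, differentiable with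
derivative `diag(2x, 2y)` of determinant `4xy`, injective on the open box `(0,1)²` (squares are
injective on positive reals) and ONTO it (inverse `(√u, √v)`); and the pull-back identity
`(c/4) (x²)^a (y²)^b/(1 − x²y²) · 4xy = c x^{2a+1} y^{2b+1}/(1 − x²y²)` holds identically. Hence
`[N] − [N'] ∈ KZ.changeOfVariablesRel ⊆ KZ.relations` for any two representations `N`, `N'` pinned
by the displayed domains and integrands (rule (2) asks for the integrand identity on the domain
only, so the `EqOn` hypotheses suffice; the algebraicity of `c` is not used, both representations
being given). Pattern of `KZ.exists_dirichletPolarChart` (`KZDirichletCharts.lean`).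

References: M. Kontsevich, D. Zagier, *Periods* (2001), §1.2 rule (2). No new definitions.
-/

noncomputable section

open MeasureTheory Set
open Literature.NumberTheory.Transcendental Literature.NumberTheory.Transcendental.KZ
open Literature.ModelTheory.ExponentialFields (IsSemialgebraic)

namespace Summit.KontsevichZagierPeriods.HurwitzMicroSectors.NormalFormPrinciple.PiBox.AlgLevelTwo

/-- **The pull-back identity** of the squares chart (Jacobian `4xy` included):
`c x^{2a+1} y^{2b+1}/(1 − x²y²) = (c/4) (x²)^a (y²)^b/(1 − x²y²) · (4xy)`, identically in `x, y`.
[folklore] -/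
theorem lt2_squares_pullback (c : ℝ) (a b : ℕ) (x y : ℝ) :
    c * (x ^ (2 * a + 1) * y ^ (2 * b + 1)) / (1 - x ^ 2 * y ^ 2) =
      c / 4 * ((x ^ 2) ^ a * (y ^ 2) ^ b) / (1 - x ^ 2 * y ^ 2) * (4 * x * y) := by
  rw [div_mul_eq_mul_div]
  congr 1
  ring

/-- **The squares chart `Φ(x,y) = (x², y²)`** of the open box `(0,1)²` onto itself: a
`ℚ`-polynomial map, differentiable with derivative `diag(2x, 2y)` and `|det DΦ| = 4xy` on the box,
injective on the box (squares of positive reals) and ONTO the box (inverse `(√u, √v)`).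
[folklore] -/
theorem lt2_exists_squaresChart :
    ∃ (Φ : (Fin 2 → ℝ) → (Fin 2 → ℝ)) (Φ' : (Fin 2 → ℝ) → (Fin 2 → ℝ) →L[ℝ] (Fin 2 → ℝ)),
      (∀ z, Φ z 0 = z 0 ^ 2) ∧ (∀ z, Φ z 1 = z 1 ^ 2) ∧
      IsSemialgebraicMapOn ℚ {x : Fin 2 → ℝ | ∀ i, x i ∈ Set.Ioo (0:ℝ) 1} Φ ∧
      (∀ z, HasFDerivAt Φ (Φ' z) z) ∧
      Set.InjOn Φ {x : Fin 2 → ℝ | ∀ i, x i ∈ Set.Ioo (0:ℝ) 1} ∧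
      Φ '' {x : Fin 2 → ℝ | ∀ i, x i ∈ Set.Ioo (0:ℝ) 1} =
        {x : Fin 2 → ℝ | ∀ i, x i ∈ Set.Ioo (0:ℝ) 1} ∧
      (∀ z ∈ {x : Fin 2 → ℝ | ∀ i, x i ∈ Set.Ioo (0:ℝ) 1}, |(Φ' z).det| = 4 * z 0 * z 1) := by
  set Φ : (Fin 2 → ℝ) → (Fin 2 → ℝ) := fun z => ![z 0 ^ 2, z 1 ^ 2] with hΦ
  set Φ' : (Fin 2 → ℝ) → (Fin 2 → ℝ) →L[ℝ] (Fin 2 → ℝ) :=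
    fun z => LinearMap.toContinuousLinearMap (Matrix.toLin' !![2 * z 0, 0; 0, 2 * z 1]) with hΦ'
  have hΦ0 : ∀ z, Φ z 0 = z 0 ^ 2 := fun z => rfl
  have hΦ1 : ∀ z, Φ z 1 = z 1 ^ 2 := fun z => rfl
  have hΦ'0 : ∀ z v : Fin 2 → ℝ, Φ' z v 0 = 2 * z 0 * v 0 := by
    intro z v
    change Matrix.toLin' !![2 * z 0, 0; 0, 2 * z 1] v 0 = _
    rw [Matrix.toLin'_apply]
    simp [Matrix.mulVec, dotProduct, Fin.sum_univ_two]
  have hΦ'1 : ∀ z v : Fin 2 → ℝ, Φ' z v 1 = 2 * z 1 * v 1 := by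
    intro z v
    change Matrix.toLin' !![2 * z 0, 0; 0, 2 * z 1] v 1 = _
    rw [Matrix.toLin'_apply]
    simp [Matrix.mulVec, dotProduct, Fin.sum_univ_two]
  have hdet : ∀ z, (Φ' z).det = 4 * z 0 * z 1 := by
    intro z
    change LinearMap.det (Matrix.toLin' !![2 * z 0, 0; 0, 2 * z 1]) = _
    rw [LinearMap.det_toLin', Matrix.det_fin_two_of]
    ring
  have hderiv : ∀ z, HasFDerivAt Φ (Φ' z) z := by
    intro z
    have h0 : HasFDerivAt (fun y : Fin 2 → ℝ => y 0)
        (ContinuousLinearMap.proj (R := ℝ) (φ := fun _ : Fin 2 => ℝ) 0) z := hasFDerivAt_apply 0 z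
    have h1 : HasFDerivAt (fun y : Fin 2 → ℝ => y 1)
        (ContinuousLinearMap.proj (R := ℝ) (φ := fun _ : Fin 2 => ℝ) 1) z := hasFDerivAt_apply 1 z
    rw [hasFDerivAt_pi']
    refine Fin.forall_fin_two.mpr ⟨?_, ?_⟩
    · have hf : (fun y : Fin 2 → ℝ => Φ y 0) = fun y => y 0 * y 0 :=
        funext fun y => by rw [hΦ0, sq]
      rw [hf]
      refine (h0.mul h0).congr_fderiv (ContinuousLinearMap.ext fun v => ?_)
      simp [hΦ'0]
      ring
    · have hf : (fun y : Fin 2 → ℝ => Φ y 1) = fun y => y 1 * y 1 :=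
        funext fun y => by rw [hΦ1, sq]
      rw [hf]
      refine (h1.mul h1).congr_fderiv (ContinuousLinearMap.ext fun v => ?_)
      simp [hΦ'1]
      ring
  refine ⟨Φ, Φ', hΦ0, hΦ1, ?_, hderiv, ?_, ?_, fun z hz => ?_⟩
  · -- a `ℚ`-polynomial map is `ℚ`-semialgebraic
    convert isSemialgebraicMapOn_aeval (isSemialgebraic_box 2)
      ![MvPolynomial.X 0 ^ 2, (MvPolynomial.X 1 ^ 2 : MvPolynomial (Fin 2) ℚ)] using 2 with z
    funext i
    fin_cases i
    · simp [hΦ0]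
    · simp [hΦ1]
  · -- injective on the positive box
    intro x hx y hy hxy
    have e0 : x 0 ^ 2 = y 0 ^ 2 := by rw [← hΦ0, ← hΦ0, hxy]
    have e1 : x 1 ^ 2 = y 1 ^ 2 := by rw [← hΦ1, ← hΦ1, hxy]
    have h0 : x 0 = y 0 := (pow_left_inj₀ (hx 0).1.le (hy 0).1.le two_ne_zero).1 e0
    have h1 : x 1 = y 1 := (pow_left_inj₀ (hx 1).1.le (hy 1).1.le two_ne_zero).1 e1
    funext i
    fin_cases i
    · exact h0
    · exact h1
  · -- onto the box
    ext y
    constructor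
    · rintro ⟨z, hz, rfl⟩
      refine Fin.forall_fin_two.mpr ⟨?_, ?_⟩
      · rw [hΦ0]
        exact ⟨pow_pos (hz 0).1 2, pow_lt_one₀ (hz 0).1.le (hz 0).2 two_ne_zero⟩
      · rw [hΦ1]
        exact ⟨pow_pos (hz 1).1 2, pow_lt_one₀ (hz 1).1.le (hz 1).2 two_ne_zero⟩
    · intro hy
      have hs : ∀ i, Real.sqrt (y i) ∈ Set.Ioo (0:ℝ) 1 := fun i =>
        ⟨Real.sqrt_pos.2 (hy i).1, by
          have h := Real.sqrt_lt_sqrt (hy i).1.le (hy i).2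
          rwa [Real.sqrt_one] at h⟩
      refine ⟨![Real.sqrt (y 0), Real.sqrt (y 1)], Fin.forall_fin_two.mpr ⟨hs 0, hs 1⟩, ?_⟩
      funext i
      fin_cases i
      · change Real.sqrt (y 0) ^ 2 = y 0
        exact Real.sq_sqrt (hy 0).1.le
      · change Real.sqrt (y 1) ^ 2 = y 1
        exact Real.sq_sqrt (hy 1).1.le
  · -- the Jacobian
    rw [hdet, abs_of_pos (mul_pos (mul_pos four_pos (hz 0).1) (hz 1).1)]

/-- **Stub T4 (the squares substitution `(x,y) ↦ (x²,y²)`, rule 2):**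
`[(0,1)², c x^{2a+1} y^{2b+1}/(1 − x²y²)] ≡ [(0,1)², (c/4) u^a v^b/(1 − uv)]`. One raw
change-of-variables move `KZ.changeOfVariablesRel` with source `N`, chart `Φ(x,y) = (x²,y²)`
(`lt2_exists_squaresChart`) and image `N'`: the pull-back identity
`N.integrand = (N'.integrand ∘ Φ) · |det DΦ|` on the box is `lt2_squares_pullback`. (The
hypothesis that `c` is algebraic is not needed: both representations are given.)
[cite: KontsevichZagier2001, §1.2 rule (2)] -/
theorem levelTwo_squares (c : ℝ) (hc : IsAlgebraic ℚ c) (a b : ℕ) (N N' : IntegralRep 2)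
    (hNd : N.domain = {x | ∀ i, x i ∈ Set.Ioo (0:ℝ) 1})
    (hNi : EqOn N.integrand
      (fun x => c * (x 0 ^ (2 * a + 1) * x 1 ^ (2 * b + 1)) / (1 - x 0 ^ 2 * x 1 ^ 2)) N.domain)
    (hN'd : N'.domain = {x | ∀ i, x i ∈ Set.Ioo (0:ℝ) 1})
    (hN'i : EqOn N'.integrand (fun x => c / 4 * (x 0 ^ a * x 1 ^ b) / (1 - x 0 * x 1)) N'.domain) :
    of N - of N' ∈ relations := by
  -- the algebraicity of `c` is not needed (both representations are given); record and drop it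
  have _ : IsAlgebraic ℚ c := hc
  clear hc
  obtain ⟨Φ, Φ', hΦ0, hΦ1, hsa, hderiv, hinj, himage, hdet⟩ := lt2_exists_squaresChart
  have himage' : N'.domain = Φ '' N.domain := by rw [hNd, himage, hN'd]
  have hsa' : IsSemialgebraicMapOn ℚ N.domain Φ := by rw [hNd]; exact hsa
  have hinj' : InjOn Φ N.domain := by rw [hNd]; exact hinj
  refine changeOfVariablesRel_subset_relations
    ⟨2, N, N', Φ, Φ', hsa', fun x _ => (hderiv x).hasFDerivWithinAt, hinj', himage',
      fun x hx => ?_, rfl⟩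
  -- the pull-back identity on `N.domain`, Jacobian `|det DΦ| = 4 x₀ x₁` included
  have hΦx : Φ x ∈ N'.domain := himage' ▸ mem_image_of_mem _ hx
  have hx' : x ∈ {x : Fin 2 → ℝ | ∀ i, x i ∈ Set.Ioo (0:ℝ) 1} := hNd ▸ hx
  rw [hNi hx, hN'i hΦx, hdet x hx']
  simp only [hΦ0, hΦ1]
  exact lt2_squares_pullback c a b (x 0) (x 1)

end Summit.KontsevichZagierPeriods.HurwitzMicroSectors.NormalFormPrinciple.PiBox.AlgLevelTwo
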